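import Summits.KontsevichZagierPeriods.KontsevichZagierPeriods.Theses.IsogenyCertificates
import Summits.KontsevichZagierPeriods.KontsevichZagierPeriods.Theorems.GenusTwoCycleTransfer.Negative.Witnesses
import Summits.KontsevichZagierPeriods.KontsevichZagierPeriods.Theorems.IsogenyCertificatesEffectiveXMapChainsStubPieceOntoComponent
import Literature.NumberTheory.Transcendental.KZSubcalculusInvariants
import Literature.NumberTheory.Transcendental.SemialgebraicLineDeriv
import Literature.NumberTheory.Transcendental.KZLogCalculusProofs

/-!
# `BiellipticRealPeriodCell` (stmt-KontsevichZagierPeriods-18685) — negative knowledge, part 1: the canonical witnesses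

Support file for the crux `IsogenyCertificates.BiellipticRealPeriodCell` (cdisprove seat, cycle 1;
work file `Cruxes/BiellipticRealPeriodCell/Disproof.lean`). On the bielliptic genus-2 curve
`y² = F₀(x) = −(x²−1)(x²−4)(x²−9) = G₀(x²)`, `G₀(u) = −(u−1)(u−4)(u−9) = −u³+14u²−49u+36` (all six
Weierstrass points real, NO unbounded real component since `lc G₀ < 0`), the positivity set
`{F₀ > 0}` has exactly the three bounded components `K₀ = (−1,1)` (through `0`), `K₊ = (2,3)` and its
mirror `K₋ = (−3,−2)` (§3: `component_central/right/left`, via the tree's `component_eq_of_Ioo`). This file shows that the honest sector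
generators `r₊ = [K₊, 1/√F₀]`, `r₋ = [K₋, 1/√F₀]`, `r₀ = [K₀, x/√F₀]` EXIST (§5; `G₀` is a cubic and
`F₀` is squarefree, §1; semialgebraicity §4; absolute integrability by domination with the model
singularity `(√(x−a))⁻¹ + (√(a+1−x))⁻¹` from `(x−a)(a+1−x) ≤ F₀`, §2/§4; values read on `ℝ` through
`MeasurableEquiv.funUnique`) and computes their values: `value r₊ = ∫₂³ dx/√F₀ > 0`,
`value r₋ = value r₊` (the sextic is even: one reflection), `value r₀ = 0` (odd integrand on the
central oval). Part 2 (`LoadBearing`) turns them into the load-bearing analysis of the crux.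
No statement of the tree is changed and no definition is introduced (the cubic and the sextic are
written out; the witnesses are existence theorems). [Kontsevich–Zagier 2001, §1.1] [folklore]
-/

noncomputable section

open Set MeasureTheory MvPolynomial
open Literature.NumberTheory.Transcendental Literature.ModelTheory.ExponentialFields
open Summit.KontsevichZagierPeriods.KontsevichZagierPeriods.Theses.IsogenyCertificates
open Summit.KontsevichZagierPeriods.HermiteRigidity.GenusTwoCycleTransferNegative
  (integrableOn_model inv_sqrt_le_model integrableOn_fin_one setIntegral_fin_one)
open Summit.KontsevichZagierPeriods.IsogenyCertificates.EffectiveXMapChainsLine.PieceOntoComponent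
  (component_eq_of_Ioo)

namespace Summit.KontsevichZagierPeriods.IsogenyCertificates.BiellipticRealPeriodCellNegative

/-! ### §1 The curve `y² = G₀(x²)`, `G₀ = −(u−1)(u−4)(u−9)` -/

/-- `G₀` is a cubic. [folklore] -/
theorem natDegree_G₀ : (Polynomial.C (-1) * Polynomial.X ^ 3 + Polynomial.C 14 * Polynomial.X ^ 2 + Polynomial.C (-49) * Polynomial.X + Polynomial.C 36 : Polynomial ℚ).natDegree = 3 :=
  Polynomial.natDegree_cubic (by norm_num)

/-- The sextic `F₀ = G₀(x²)` as a real function. [folklore] -/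
theorem aeval_F₀ (y : ℝ) : Polynomial.aeval y ((Polynomial.C (-1) * Polynomial.X ^ 3 + Polynomial.C 14 * Polynomial.X ^ 2 + Polynomial.C (-49) * Polynomial.X + Polynomial.C 36 : Polynomial ℚ).comp (Polynomial.X ^ 2)) =
    -((y ^ 2 - 1) * (y ^ 2 - 4) * (y ^ 2 - 9)) := by
  simp only [Polynomial.aeval_comp, map_add, map_mul, Polynomial.aeval_C, Polynomial.aeval_X,
    map_pow, map_neg, eq_ratCast]
  push_cast
  ring

/-- The sextic factors over `ℚ` into six distinct linear factors. [folklore] -/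
theorem comp_G₀_eq_prod : (Polynomial.C (-1) * Polynomial.X ^ 3 + Polynomial.C 14 * Polynomial.X ^ 2 + Polynomial.C (-49) * Polynomial.X + Polynomial.C 36 : Polynomial ℚ).comp (Polynomial.X ^ 2) * Polynomial.C (-1 : ℚ) =
    ∏ i : Fin 6, (Polynomial.X - Polynomial.C ((![1, -1, 2, -2, 3, -3] : Fin 6 → ℚ) i)) := by
  simp only [Polynomial.add_comp, Polynomial.mul_comp, Polynomial.C_comp, Polynomial.X_pow_comp,
    Polynomial.X_comp, Fin.prod_univ_six]
  have e0 : (![1, -1, 2, -2, 3, -3] : Fin 6 → ℚ) 0 = 1 := rfl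
  have e1 : (![1, -1, 2, -2, 3, -3] : Fin 6 → ℚ) 1 = -1 := rfl
  have e2 : (![1, -1, 2, -2, 3, -3] : Fin 6 → ℚ) 2 = 2 := rfl
  have e3 : (![1, -1, 2, -2, 3, -3] : Fin 6 → ℚ) 3 = -2 := rfl
  have e4 : (![1, -1, 2, -2, 3, -3] : Fin 6 → ℚ) 4 = 3 := rfl
  have e5 : (![1, -1, 2, -2, 3, -3] : Fin 6 → ℚ) 5 = -3 := rfl
  simp only [e0, e1, e2, e3, e4, e5, map_neg, map_one]
  have h2 : (Polynomial.C (2 : ℚ)) = 2 := rfl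
  have h3 : (Polynomial.C (3 : ℚ)) = 3 := rfl
  have h14 : (Polynomial.C (14 : ℚ)) = 14 := rfl
  have h49 : (Polynomial.C (49 : ℚ)) = 49 := rfl
  have h36 : (Polynomial.C (36 : ℚ)) = 36 := rfl
  rw [h2, h3, h14, h49, h36]
  ring

/-- `F₀ = G₀(x²)` is squarefree (six distinct roots `±1, ±2, ±3`). [folklore] -/
theorem squarefree_comp_G₀ : Squarefree ((Polynomial.C (-1) * Polynomial.X ^ 3 + Polynomial.C 14 * Polynomial.X ^ 2 + Polynomial.C (-49) * Polynomial.X + Polynomial.C 36 : Polynomial ℚ).comp (Polynomial.X ^ 2)) := by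
  have hsep : (∏ i : Fin 6, (Polynomial.X - Polynomial.C ((![1, -1, 2, -2, 3, -3] : Fin 6 → ℚ) i))).Separable := by
    rw [Polynomial.separable_prod_X_sub_C_iff']
    decide
  exact (hsep.squarefree).squarefree_of_dvd ⟨Polynomial.C (-1 : ℚ), comp_G₀_eq_prod.symm⟩

/-- The sextic `−(x²−1)(x²−4)(x²−9)` is even. [folklore] -/
theorem sextic_even (x : ℝ) :
    -(((-x) ^ 2 - 1) * ((-x) ^ 2 - 4) * ((-x) ^ 2 - 9)) = -((x ^ 2 - 1) * (x ^ 2 - 4) * (x ^ 2 - 9)) := by ring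

/-! ### §2 Signs and the model domination on the three ovals -/

/-- On `K₊ = (2,3)`: `(x−2)(2+1−x) ≤ F₀(x)` (the cofactor `(x²−1)(x+2)(x+3)` is `≥ 60`). [folklore] -/
theorem sextic_ge_23 {x : ℝ} (hx : x ∈ Ioo (2:ℝ) 3) :
    (x - 2) * (2 + 1 - x) ≤ -((x ^ 2 - 1) * (x ^ 2 - 4) * (x ^ 2 - 9)) := by
  have h1 : 0 < x - 2 := by linarith [hx.1]
  have h2 : 0 < 3 - x := by linarith [hx.2]
  have h3 : (3:ℝ) ≤ x ^ 2 - 1 := by nlinarith [hx.1]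
  have h4 : (4:ℝ) ≤ x + 2 := by linarith [hx.1]
  have h5 : (5:ℝ) ≤ x + 3 := by linarith [hx.1]
  have hab : (3:ℝ) * 4 ≤ (x ^ 2 - 1) * (x + 2) := mul_le_mul h3 h4 (by norm_num) (by linarith)
  have habc : (3:ℝ) * 4 * 5 ≤ (x ^ 2 - 1) * (x + 2) * (x + 3) :=
    mul_le_mul hab h5 (by norm_num) (by nlinarith)
  have key : -((x ^ 2 - 1) * (x ^ 2 - 4) * (x ^ 2 - 9)) =
      (x - 2) * (3 - x) * ((x ^ 2 - 1) * (x + 2) * (x + 3)) := by ring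
  rw [key]
  have hpos : 0 ≤ (x - 2) * (3 - x) := le_of_lt (mul_pos h1 h2)
  calc (x - 2) * (2 + 1 - x) = (x - 2) * (3 - x) * 1 := by ring
    _ ≤ (x - 2) * (3 - x) * ((x ^ 2 - 1) * (x + 2) * (x + 3)) :=
        mul_le_mul_of_nonneg_left (by linarith) hpos

/-- `F₀ > 0` on `K₊ = (2,3)`. [folklore] -/
theorem sextic_pos_23 {x : ℝ} (hx : x ∈ Ioo (2:ℝ) 3) : 0 < -((x ^ 2 - 1) * (x ^ 2 - 4) * (x ^ 2 - 9)) :=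
  lt_of_lt_of_le (mul_pos (by linarith [hx.1]) (by linarith [hx.2])) (sextic_ge_23 hx)

/-- On the mirror `K₋ = (−3,−2)`: `(x−(−3))(−3+1−x) ≤ F₀(x)` (evenness). [folklore] -/
theorem sextic_ge_neg {x : ℝ} (hx : x ∈ Ioo (-3:ℝ) (-2)) :
    (x - (-3)) * (-3 + 1 - x) ≤ -((x ^ 2 - 1) * (x ^ 2 - 4) * (x ^ 2 - 9)) := by
  have hx' : -x ∈ Ioo (2:ℝ) 3 := ⟨by linarith [hx.2], by linarith [hx.1]⟩
  have h := sextic_ge_23 hx'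
  rw [sextic_even] at h
  calc (x - (-3)) * (-3 + 1 - x) = (-x - 2) * (2 + 1 - -x) := by ring
    _ ≤ _ := h

/-- `F₀ > 0` on `K₋ = (−3,−2)`. [folklore] -/
theorem sextic_pos_neg {x : ℝ} (hx : x ∈ Ioo (-3:ℝ) (-2)) : 0 < -((x ^ 2 - 1) * (x ^ 2 - 4) * (x ^ 2 - 9)) := by
  have h := sextic_pos_23 (x := -x) ⟨by linarith [hx.2], by linarith [hx.1]⟩
  rwa [sextic_even] at h

/-- On the right half `(0,1)` of the central oval: `x(0+1−x) ≤ F₀(x)`. [folklore] -/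
theorem sextic_ge_01 {x : ℝ} (hx : x ∈ Ioo (0:ℝ) 1) :
    (x - 0) * (0 + 1 - x) ≤ -((x ^ 2 - 1) * (x ^ 2 - 4) * (x ^ 2 - 9)) := by
  have h1 : 0 < x := hx.1
  have h2 : 0 < 1 - x := by linarith [hx.2]
  have hx2 : x ^ 2 < 1 := by nlinarith
  have h4 : (3:ℝ) ≤ 4 - x ^ 2 := by linarith
  have h5 : (8:ℝ) ≤ 9 - x ^ 2 := by linarith
  have h45 : (3:ℝ) * 8 ≤ (4 - x ^ 2) * (9 - x ^ 2) := mul_le_mul h4 h5 (by norm_num) (by linarith)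
  have key : -((x ^ 2 - 1) * (x ^ 2 - 4) * (x ^ 2 - 9)) =
      (1 - x) * ((1 + x) * ((4 - x ^ 2) * (9 - x ^ 2))) := by ring
  rw [key]
  have h24 : (3:ℝ) * 8 * 1 ≤ (4 - x ^ 2) * (9 - x ^ 2) * (1 + x) :=
    mul_le_mul h45 (by linarith) (by norm_num) (by nlinarith)
  have hone : x ≤ (1 + x) * ((4 - x ^ 2) * (9 - x ^ 2)) := by nlinarith [hx.2]
  calc (x - 0) * (0 + 1 - x) = (1 - x) * x := by ring
    _ ≤ (1 - x) * ((1 + x) * ((4 - x ^ 2) * (9 - x ^ 2))) := mul_le_mul_of_nonneg_left hone (le_of_lt h2)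

/-- On the left half `(−1,0)` of the central oval: `(x−(−1))(−1+1−x) ≤ F₀(x)` (evenness). [folklore] -/
theorem sextic_ge_neg10 {x : ℝ} (hx : x ∈ Ioo (-1:ℝ) 0) :
    (x - (-1)) * (-1 + 1 - x) ≤ -((x ^ 2 - 1) * (x ^ 2 - 4) * (x ^ 2 - 9)) := by
  have hx' : -x ∈ Ioo (0:ℝ) 1 := ⟨by linarith [hx.2], by linarith [hx.1]⟩
  have h := sextic_ge_01 hx'
  rw [sextic_even] at h
  calc (x - (-1)) * (-1 + 1 - x) = (-x - 0) * (0 + 1 - -x) := by ring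
    _ ≤ _ := h

/-- `F₀ > 0` on the central oval `K₀ = (−1,1)`. [folklore] -/
theorem sextic_pos_central {x : ℝ} (hx : x ∈ Ioo (-1:ℝ) 1) : 0 < -((x ^ 2 - 1) * (x ^ 2 - 4) * (x ^ 2 - 9)) := by
  have hx2 : x ^ 2 < 1 := by nlinarith [hx.1, hx.2]
  have h1 : 0 < 1 - x ^ 2 := by linarith
  have h4 : 0 < 4 - x ^ 2 := by linarith
  have h9 : 0 < 9 - x ^ 2 := by linarith
  nlinarith [mul_pos (mul_pos h1 h4) h9]

/-! ### §3 The three components of `{F₀ > 0}` -/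

/-- The positivity set of the sextic, in coordinates. [folklore] -/
theorem posSet_eq : {y : ℝ | 0 < Polynomial.aeval y ((Polynomial.C (-1) * Polynomial.X ^ 3 + Polynomial.C 14 * Polynomial.X ^ 2 + Polynomial.C (-49) * Polynomial.X + Polynomial.C 36 : Polynomial ℚ).comp (Polynomial.X ^ 2))} =
    {y : ℝ | 0 < -((y ^ 2 - 1) * (y ^ 2 - 4) * (y ^ 2 - 9))} := by
  ext y; simp only [mem_setOf_eq, aeval_F₀]

/-- The component through `5/2` is `K₊ = (2,3)`. [folklore] -/
theorem component_right : connectedComponentIn {y : ℝ | 0 < Polynomial.aeval y ((Polynomial.C (-1) * Polynomial.X ^ 3 + Polynomial.C 14 * Polynomial.X ^ 2 + Polynomial.C (-49) * Polynomial.X + Polynomial.C 36 : Polynomial ℚ).comp (Polynomial.X ^ 2))}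
    (((5/2 : ℚ) : ℝ)) = Ioo 2 3 := by
  rw [posSet_eq]
  refine component_eq_of_Ioo ?_ ?_ (fun x hx => sextic_pos_23 hx) ⟨by norm_num, by norm_num⟩
  · simp only [mem_setOf_eq]; norm_num
  · simp only [mem_setOf_eq]; norm_num

/-- The component through `−5/2` is the mirror `K₋ = (−3,−2)`. [folklore] -/
theorem component_left : connectedComponentIn {y : ℝ | 0 < Polynomial.aeval y ((Polynomial.C (-1) * Polynomial.X ^ 3 + Polynomial.C 14 * Polynomial.X ^ 2 + Polynomial.C (-49) * Polynomial.X + Polynomial.C 36 : Polynomial ℚ).comp (Polynomial.X ^ 2))}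
    (((-5/2 : ℚ) : ℝ)) = Ioo (-3) (-2) := by
  rw [posSet_eq]
  refine component_eq_of_Ioo ?_ ?_ (fun x hx => sextic_pos_neg hx) ⟨by norm_num, by norm_num⟩
  · simp only [mem_setOf_eq]; norm_num
  · simp only [mem_setOf_eq]; norm_num

/-- The component through `0` is the central oval `K₀ = (−1,1)`. [folklore] -/
theorem component_central : connectedComponentIn {y : ℝ | 0 < Polynomial.aeval y ((Polynomial.C (-1) * Polynomial.X ^ 3 + Polynomial.C 14 * Polynomial.X ^ 2 + Polynomial.C (-49) * Polynomial.X + Polynomial.C 36 : Polynomial ℚ).comp (Polynomial.X ^ 2))}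
    (((0 : ℚ) : ℝ)) = Ioo (-1) 1 := by
  rw [posSet_eq]
  refine component_eq_of_Ioo ?_ ?_ (fun x hx => sextic_pos_central hx) ⟨by norm_num, by norm_num⟩
  · simp only [mem_setOf_eq]; norm_num
  · simp only [mem_setOf_eq]; norm_num

/-- `K₊` is bounded. [folklore] -/
theorem isBounded_component_right : Bornology.IsBounded (connectedComponentIn
    {y : ℝ | 0 < Polynomial.aeval y ((Polynomial.C (-1) * Polynomial.X ^ 3 + Polynomial.C 14 * Polynomial.X ^ 2 + Polynomial.C (-49) * Polynomial.X + Polynomial.C 36 : Polynomial ℚ).comp (Polynomial.X ^ 2))} (((5/2 : ℚ) : ℝ))) := by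
  rw [component_right]; exact Metric.isBounded_Ioo 2 3

/-- `K₋` is bounded. [folklore] -/
theorem isBounded_component_left : Bornology.IsBounded (connectedComponentIn
    {y : ℝ | 0 < Polynomial.aeval y ((Polynomial.C (-1) * Polynomial.X ^ 3 + Polynomial.C 14 * Polynomial.X ^ 2 + Polynomial.C (-49) * Polynomial.X + Polynomial.C 36 : Polynomial ℚ).comp (Polynomial.X ^ 2))} (((-5/2 : ℚ) : ℝ))) := by
  rw [component_left]; exact Metric.isBounded_Ioo (-3) (-2)

/-- `K₀` is bounded. [folklore] -/
theorem isBounded_component_central : Bornology.IsBounded (connectedComponentIn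
    {y : ℝ | 0 < Polynomial.aeval y ((Polynomial.C (-1) * Polynomial.X ^ 3 + Polynomial.C 14 * Polynomial.X ^ 2 + Polynomial.C (-49) * Polynomial.X + Polynomial.C 36 : Polynomial ℚ).comp (Polynomial.X ^ 2))} (((0 : ℚ) : ℝ))) := by
  rw [component_central]; exact Metric.isBounded_Ioo (-1) 1

/-! ### §4 Semialgebraicity and absolute integrability -/

/-- An open interval with rational ends, read in `ℝ¹`, is `ℚ`-semialgebraic. [cite: BochnakCosteRoy1998, §2.1] -/
theorem isSemialgebraic_Ioo_fin_one (a b : ℚ) :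
    IsSemialgebraic ℚ {p : Fin 1 → ℝ | p 0 ∈ Ioo (a : ℝ) (b : ℝ)} := by
  have h1 := isSemialgebraic_setOf_eval_lt (k := ℚ) (R := ℝ) (C a : MvPolynomial (Fin 1) ℚ) (X 0)
  have h2 := isSemialgebraic_setOf_eval_lt (k := ℚ) (R := ℝ) (X 0 : MvPolynomial (Fin 1) ℚ) (C b)
  simp only [aeval_X, aeval_C, eq_ratCast] at h1 h2
  have : {p : Fin 1 → ℝ | p 0 ∈ Ioo (a : ℝ) (b : ℝ)} = {x | (a : ℝ) < x 0} ∩ {x | x 0 < (b : ℝ)} := by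
    ext p; simp only [mem_setOf_eq, mem_Ioo, mem_inter_iff]
  rw [this]
  exact h1.inter h2

/-- `K₊ = (2,3) ⊆ ℝ¹` is `ℚ`-semialgebraic. [cite: BochnakCosteRoy1998, §2.1] -/
theorem isSemialgebraic_K_right : IsSemialgebraic ℚ {p : Fin 1 → ℝ | p 0 ∈ Ioo (2:ℝ) 3} := by
  have h := isSemialgebraic_Ioo_fin_one 2 3; norm_num at h; exact h

/-- `K₋ = (−3,−2) ⊆ ℝ¹` is `ℚ`-semialgebraic. [cite: BochnakCosteRoy1998, §2.1] -/
theorem isSemialgebraic_K_left : IsSemialgebraic ℚ {p : Fin 1 → ℝ | p 0 ∈ Ioo (-3:ℝ) (-2)} := by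
  have h := isSemialgebraic_Ioo_fin_one (-3) (-2); norm_num at h; exact h

/-- `K₀ = (−1,1) ⊆ ℝ¹` is `ℚ`-semialgebraic. [cite: BochnakCosteRoy1998, §2.1] -/
theorem isSemialgebraic_K_central : IsSemialgebraic ℚ {p : Fin 1 → ℝ | p 0 ∈ Ioo (-1:ℝ) 1} := by
  have h := isSemialgebraic_Ioo_fin_one (-1) 1; norm_num at h; exact h

/-- Where `F₀ > 0`, `1/√F₀ = √(1/F₀)` is a `ℚ`-semialgebraic function. [cite: BochnakCosteRoy1998, Prop. 2.2.6] -/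
theorem invSqrt_semialgebraic {σ : Set (Fin 1 → ℝ)} (hσ : IsSemialgebraic ℚ σ)
    (hf : ∀ p ∈ σ, 0 < -((p 0 ^ 2 - 1) * (p 0 ^ 2 - 4) * (p 0 ^ 2 - 9))) :
    IsSemialgebraicFunOn ℚ σ (fun p => 1 / Real.sqrt (-((p 0 ^ 2 - 1) * (p 0 ^ 2 - 4) * (p 0 ^ 2 - 9)))) := by
  have h1 := isSemialgebraicFunOn_aeval_div_aeval hσ (1 : MvPolynomial (Fin 1) ℚ)
    (-((X 0 ^ 2 - 1) * (X 0 ^ 2 - 4) * (X 0 ^ 2 - 9))) (fun p hp => by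
      simpa using (hf p hp).ne')
  have h2 : IsSemialgebraicFunOn ℚ σ (fun p => 1 / -((p 0 ^ 2 - 1) * (p 0 ^ 2 - 4) * (p 0 ^ 2 - 9))) :=
    h1.congr (fun p _ => by simp)
  refine (h2.fun_sqrt).congr (fun p _ => ?_)
  simp only [one_div, Real.sqrt_inv]

/-- … and so is `x/√F₀ = x · (1/√F₀)`. [cite: BochnakCosteRoy1998, Prop. 2.2.6] -/
theorem xInvSqrt_semialgebraic {σ : Set (Fin 1 → ℝ)} (hσ : IsSemialgebraic ℚ σ)
    (hf : ∀ p ∈ σ, 0 < -((p 0 ^ 2 - 1) * (p 0 ^ 2 - 4) * (p 0 ^ 2 - 9))) :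
    IsSemialgebraicFunOn ℚ σ (fun p => p 0 / Real.sqrt (-((p 0 ^ 2 - 1) * (p 0 ^ 2 - 4) * (p 0 ^ 2 - 9)))) := by
  refine ((Literature.NumberTheory.Transcendental.isSemialgebraicFunOn_apply hσ 0).fun_mul
    (invSqrt_semialgebraic hσ hf)).congr (fun p _ => ?_)
  simp only [mul_one_div]

/-- `1/√F₀` is Borel measurable on `ℝ`. [folklore] -/
theorem measurable_invSqrt : Measurable (fun x : ℝ => 1 / Real.sqrt (-((x ^ 2 - 1) * (x ^ 2 - 4) * (x ^ 2 - 9)))) := by fun_prop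

/-- `x/√F₀` is Borel measurable on `ℝ`. [folklore] -/
theorem measurable_xInvSqrt : Measurable (fun x : ℝ => x / Real.sqrt (-((x ^ 2 - 1) * (x ^ 2 - 4) * (x ^ 2 - 9)))) := by fun_prop

/-- `1/√F₀` is integrable on `K₊ = (2,3)`. [folklore] -/
theorem integrableOn_invSqrt_right :
    IntegrableOn (fun x : ℝ => 1 / Real.sqrt (-((x ^ 2 - 1) * (x ^ 2 - 4) * (x ^ 2 - 9)))) (Ioo 2 3) := by
  refine Integrable.mono' (integrableOn_model 2 (2 + 1) |>.mono_set (by norm_num))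
    measurable_invSqrt.aestronglyMeasurable ?_
  filter_upwards [ae_restrict_mem measurableSet_Ioo] with x hx
  rw [Real.norm_of_nonneg (by positivity)]
  exact inv_sqrt_le_model (a := 2) (by norm_num at hx ⊢; exact hx) (sextic_ge_23 hx)

/-- `1/√F₀` is integrable on `K₋ = (−3,−2)`. [folklore] -/
theorem integrableOn_invSqrt_left :
    IntegrableOn (fun x : ℝ => 1 / Real.sqrt (-((x ^ 2 - 1) * (x ^ 2 - 4) * (x ^ 2 - 9)))) (Ioo (-3) (-2)) := by
  refine Integrable.mono' (integrableOn_model (-3) (-3 + 1) |>.mono_set (by norm_num))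
    measurable_invSqrt.aestronglyMeasurable ?_
  filter_upwards [ae_restrict_mem measurableSet_Ioo] with x hx
  rw [Real.norm_of_nonneg (by positivity)]
  exact inv_sqrt_le_model (a := -3) (by norm_num at hx ⊢; exact hx) (sextic_ge_neg hx)

/-- `1/√F₀` is integrable on the right half `(0,1)` of the central oval. [folklore] -/
theorem integrableOn_invSqrt_01 :
    IntegrableOn (fun x : ℝ => 1 / Real.sqrt (-((x ^ 2 - 1) * (x ^ 2 - 4) * (x ^ 2 - 9)))) (Ioo 0 1) := by
  refine Integrable.mono' (integrableOn_model 0 (0 + 1) |>.mono_set (by norm_num))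
    measurable_invSqrt.aestronglyMeasurable ?_
  filter_upwards [ae_restrict_mem measurableSet_Ioo] with x hx
  rw [Real.norm_of_nonneg (by positivity)]
  exact inv_sqrt_le_model (a := 0) (by norm_num at hx ⊢; exact hx) (sextic_ge_01 hx)

/-- `1/√F₀` is integrable on the left half `(−1,0)` of the central oval. [folklore] -/
theorem integrableOn_invSqrt_neg10 :
    IntegrableOn (fun x : ℝ => 1 / Real.sqrt (-((x ^ 2 - 1) * (x ^ 2 - 4) * (x ^ 2 - 9)))) (Ioo (-1) 0) := by
  refine Integrable.mono' (integrableOn_model (-1) (-1 + 1) |>.mono_set (by norm_num))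
    measurable_invSqrt.aestronglyMeasurable ?_
  filter_upwards [ae_restrict_mem measurableSet_Ioo] with x hx
  rw [Real.norm_of_nonneg (by positivity)]
  exact inv_sqrt_le_model (a := -1) (by norm_num at hx ⊢; exact hx) (sextic_ge_neg10 hx)

/-- `1/√F₀` is integrable on the central oval `K₀ = (−1,1)` (glue at `0`). [folklore] -/
theorem integrableOn_invSqrt_central :
    IntegrableOn (fun x : ℝ => 1 / Real.sqrt (-((x ^ 2 - 1) * (x ^ 2 - 4) * (x ^ 2 - 9)))) (Ioo (-1) 1) := by
  have h : Ioo (-1:ℝ) 1 = Ioc (-1) 0 ∪ Ioo 0 1 := (Ioc_union_Ioo_eq_Ioo (by norm_num) (by norm_num)).symm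
  rw [h]
  refine IntegrableOn.union ?_ integrableOn_invSqrt_01
  rw [integrableOn_Ioc_iff_integrableOn_Ioo]
  exact integrableOn_invSqrt_neg10

/-- `x/√F₀` is integrable on the central oval (`|x| ≤ 1` there). [folklore] -/
theorem integrableOn_xInvSqrt_central :
    IntegrableOn (fun x : ℝ => x / Real.sqrt (-((x ^ 2 - 1) * (x ^ 2 - 4) * (x ^ 2 - 9)))) (Ioo (-1) 1) := by
  refine Integrable.mono' integrableOn_invSqrt_central measurable_xInvSqrt.aestronglyMeasurable ?_
  filter_upwards [ae_restrict_mem measurableSet_Ioo] with x hx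
  have hs : 0 < Real.sqrt (-((x ^ 2 - 1) * (x ^ 2 - 4) * (x ^ 2 - 9))) :=
    Real.sqrt_pos.mpr (sextic_pos_central hx)
  rw [norm_div, Real.norm_of_nonneg hs.le, Real.norm_eq_abs]
  exact div_le_div_of_nonneg_right (abs_le.2 ⟨le_of_lt hx.1, le_of_lt hx.2⟩) hs.le

/-! ### §5 The three witness representations exist; their values -/

/-- **`r₊ = [K₊, 1/√F₀]` exists** as an honest representation (`K₊ = (2,3)`).
[cite: KontsevichZagier2001, §1.1] -/
theorem exists_repRight : ∃ r : KZ.IntegralRep 1, r.domain = {p | p 0 ∈ Ioo (2:ℝ) 3} ∧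
    r.integrand = (fun p => 1 / Real.sqrt (-((p 0 ^ 2 - 1) * (p 0 ^ 2 - 4) * (p 0 ^ 2 - 9)))) :=
  ⟨⟨{p | p 0 ∈ Ioo (2:ℝ) 3}, fun p => 1 / Real.sqrt (-((p 0 ^ 2 - 1) * (p 0 ^ 2 - 4) * (p 0 ^ 2 - 9))), isSemialgebraic_K_right,
    invSqrt_semialgebraic isSemialgebraic_K_right fun _ hp => sextic_pos_23 hp,
    integrableOn_fin_one integrableOn_invSqrt_right⟩, rfl, rfl⟩

/-- **`r₋ = [K₋, 1/√F₀]` exists** (`K₋ = (−3,−2)`). [cite: KontsevichZagier2001, §1.1] -/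
theorem exists_repLeft : ∃ r : KZ.IntegralRep 1, r.domain = {p | p 0 ∈ Ioo (-3:ℝ) (-2)} ∧
    r.integrand = (fun p => 1 / Real.sqrt (-((p 0 ^ 2 - 1) * (p 0 ^ 2 - 4) * (p 0 ^ 2 - 9)))) :=
  ⟨⟨{p | p 0 ∈ Ioo (-3:ℝ) (-2)}, fun p => 1 / Real.sqrt (-((p 0 ^ 2 - 1) * (p 0 ^ 2 - 4) * (p 0 ^ 2 - 9))), isSemialgebraic_K_left,
    invSqrt_semialgebraic isSemialgebraic_K_left fun _ hp => sextic_pos_neg hp,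
    integrableOn_fin_one integrableOn_invSqrt_left⟩, rfl, rfl⟩

/-- **`r₀ = [K₀, x/√F₀]` exists** (the ODD first-kind differential on the central oval). [cite: KontsevichZagier2001, §1.1] -/
theorem exists_repCentral : ∃ r : KZ.IntegralRep 1, r.domain = {p | p 0 ∈ Ioo (-1:ℝ) 1} ∧
    r.integrand = (fun p => p 0 / Real.sqrt (-((p 0 ^ 2 - 1) * (p 0 ^ 2 - 4) * (p 0 ^ 2 - 9)))) :=
  ⟨⟨{p | p 0 ∈ Ioo (-1:ℝ) 1}, fun p => p 0 / Real.sqrt (-((p 0 ^ 2 - 1) * (p 0 ^ 2 - 4) * (p 0 ^ 2 - 9))), isSemialgebraic_K_central,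
    xInvSqrt_semialgebraic isSemialgebraic_K_central fun _ hp => sextic_pos_central hp,
    integrableOn_fin_one (S := Ioo (-1) 1) (g := fun x => x / Real.sqrt (-((x ^ 2 - 1) * (x ^ 2 - 4) * (x ^ 2 - 9)))) integrableOn_xInvSqrt_central⟩,
    rfl, rfl⟩

/-- The value of a representation `[{p | p 0 ∈ S}, g (p 0)]` is `∫_S g`. [folklore] -/
theorem value_eq_of_eq {r : KZ.IntegralRep 1} {S : Set ℝ} {g : ℝ → ℝ} (hd : r.domain = {p | p 0 ∈ S})
    (hi : r.integrand = fun p => g (p 0)) : r.value = ∫ x in S, g x := by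
  rw [KZ.IntegralRep.value, hd, hi]
  exact setIntegral_fin_one g S

/-- **`∫₂³ dx/√F₀ > 0`** (positive integrand on a set of positive measure). [folklore] -/
theorem integral_right_pos : 0 < ∫ x in Ioo (2:ℝ) 3, 1 / Real.sqrt (-((x ^ 2 - 1) * (x ^ 2 - 4) * (x ^ 2 - 9))) := by
  rw [setIntegral_pos_iff_support_of_nonneg_ae (Filter.Eventually.of_forall fun x => by positivity)
    integrableOn_invSqrt_right]
  have : Function.support (fun x : ℝ => 1 / Real.sqrt (-((x ^ 2 - 1) * (x ^ 2 - 4) * (x ^ 2 - 9)))) ∩ Ioo 2 3 = Ioo 2 3 := by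
    refine inter_eq_right.mpr fun x hx => ?_
    rw [Function.mem_support]
    exact (one_div_pos.mpr (Real.sqrt_pos.mpr (sextic_pos_23 hx))).ne'
  rw [this]
  simp only [Real.volume_Ioo, ENNReal.ofReal_pos]
  norm_num

/-- **`∫₋₃⁻² dx/√F₀ = ∫₂³ dx/√F₀`** (the sextic is even: reflect `x ↦ −x`). [folklore] -/
theorem integral_left_eq_right :
    ∫ x in Ioo (-3:ℝ) (-2), 1 / Real.sqrt (-((x ^ 2 - 1) * (x ^ 2 - 4) * (x ^ 2 - 9))) = ∫ x in Ioo (2:ℝ) 3, 1 / Real.sqrt (-((x ^ 2 - 1) * (x ^ 2 - 4) * (x ^ 2 - 9))) := by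
  rw [← integral_Ioc_eq_integral_Ioo, ← integral_Ioc_eq_integral_Ioo,
    ← intervalIntegral.integral_of_le (by norm_num), ← intervalIntegral.integral_of_le (by norm_num)]
  have h := intervalIntegral.integral_comp_neg (a := (2:ℝ)) (b := 3) (fun x : ℝ => 1 / Real.sqrt (-((x ^ 2 - 1) * (x ^ 2 - 4) * (x ^ 2 - 9))))
  simp only [sextic_even] at h
  rw [← h]

/-- **`∫₋₁¹ x dx/√F₀ = 0`**: odd integrand on a symmetric interval. [folklore] -/
theorem integral_central_eq_zero : ∫ x in Ioo (-1:ℝ) 1, x / Real.sqrt (-((x ^ 2 - 1) * (x ^ 2 - 4) * (x ^ 2 - 9))) = 0 := by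
  rw [← integral_Ioc_eq_integral_Ioo, ← intervalIntegral.integral_of_le (by norm_num)]
  have h := intervalIntegral.integral_comp_neg (a := (-1:ℝ)) (b := 1) (fun x : ℝ => x / Real.sqrt (-((x ^ 2 - 1) * (x ^ 2 - 4) * (x ^ 2 - 9))))
  simp only [sextic_even, neg_div, intervalIntegral.integral_neg, neg_neg] at h
  linarith

/-- `value r₊ = ∫₂³ dx/√F₀ > 0`. [folklore] -/
theorem value_right {r : KZ.IntegralRep 1} (hd : r.domain = {p | p 0 ∈ Ioo (2:ℝ) 3})
    (hi : r.integrand = fun p => 1 / Real.sqrt (-((p 0 ^ 2 - 1) * (p 0 ^ 2 - 4) * (p 0 ^ 2 - 9)))) :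
    r.value = ∫ x in Ioo (2:ℝ) 3, 1 / Real.sqrt (-((x ^ 2 - 1) * (x ^ 2 - 4) * (x ^ 2 - 9))) :=
  value_eq_of_eq (g := fun x => 1 / Real.sqrt (-((x ^ 2 - 1) * (x ^ 2 - 4) * (x ^ 2 - 9)))) hd hi

/-- `value r₋ = value r₊`. [folklore] -/
theorem value_left {r : KZ.IntegralRep 1} (hd : r.domain = {p | p 0 ∈ Ioo (-3:ℝ) (-2)})
    (hi : r.integrand = fun p => 1 / Real.sqrt (-((p 0 ^ 2 - 1) * (p 0 ^ 2 - 4) * (p 0 ^ 2 - 9)))) :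
    r.value = ∫ x in Ioo (2:ℝ) 3, 1 / Real.sqrt (-((x ^ 2 - 1) * (x ^ 2 - 4) * (x ^ 2 - 9))) :=
  (value_eq_of_eq (g := fun x => 1 / Real.sqrt (-((x ^ 2 - 1) * (x ^ 2 - 4) * (x ^ 2 - 9)))) hd hi).trans integral_left_eq_right

/-- `value r₀ = 0`. [folklore] -/
theorem value_central {r : KZ.IntegralRep 1} (hd : r.domain = {p | p 0 ∈ Ioo (-1:ℝ) 1})
    (hi : r.integrand = fun p => p 0 / Real.sqrt (-((p 0 ^ 2 - 1) * (p 0 ^ 2 - 4) * (p 0 ^ 2 - 9)))) : r.value = 0 :=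
  (value_eq_of_eq (g := fun x => x / Real.sqrt (-((x ^ 2 - 1) * (x ^ 2 - 4) * (x ^ 2 - 9)))) hd hi).trans integral_central_eq_zero

end Summit.KontsevichZagierPeriods.IsogenyCertificates.BiellipticRealPeriodCellNegative
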